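import Summits.QuantumFields.BalabanUV.Beta.EriceFlowEnclosureCesaroTauberianSeq

/-!
# Beta / EriceFlowEnclosureCesaroTauberianSeqHigherOrder — HIGHER CESÀRO ORDERS ADD NOTHING FOR BOUNDED SEQUENCES EITHER: the (C,1) means
# `σ_N = N⁻¹Σ_{n<N} a_n` of a BOUNDED sequence (|a_n| ≤ C) are automatically 2C-log-Lipschitz in the window sense —
#     **`|σ_i − σ_N| ≤ 2C·(1 − N∕i) ≤ 2C·log(i∕N)`**   (1 ≤ N ≤ i)
# — hence slowly oscillating with NO hypothesis on a, so by Schmidt's theorem (P2 #53a) **the (C,2) datum IS the (C,1) datum**: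
# `N⁻¹Σ_{n<N} σ_n → m ⟺ σ_N → m`, no clause; every Hölder mean of a bounded sequence is again bounded by C, so ALL ORDERS CARRY ONE DATUM; and
# in the Tauberian class (a slowly oscillating) all three ⟺ `a_n → m`.  The discrete twin at ∞ of row L122 (P2 #52a `cesaro_of_cesaro2` for
# bounded functions at 0⁺); on the bare side: averaging the cutoff average of a bounded deviation AGAIN cannot create its limit
# (pure [folklore] SERVICE; imports P2 #53a only).
# (β-flow team, prover 2 = lower ∕ positivity side, unit `b2b-balaban-beta-bflow-p2`, gen 36; module P2 #53l; no Erice sentence occurs)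

HONEST FRAMING (page 1 of everything the β sub-cell writes): discharging `BetaPertH` makes Bałaban's UV stability UNCONDITIONAL — a
real constructive-QFT result; it is NOT the continuum limit and NOT the Clay problem.  HONEST DEPENDENCY (cell reorg 2026-08-19,
verbatim): «continuum YM on T⁴ ⇐ BetaPertH ∧ nine spine estimates (0/9 proved); BetaPertH ⇐ (D1) ∧ (D4) ∧ CAP+tail; G-an2-4 gates
asym, D1 and NE2/3/4.»  THIS MODULE DISCHARGES NOTHING and quotes nothing: [folklore] sequences-and-series analysis (the Knopp–Schnee ∕ Hardy
«all Cesàro ∕ Hölder orders are equivalent for bounded sequences» shape, Hardy, Divergent Series Chs. V–VI, via R. Schmidt's theorem).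

THE POINT.  `σ_i − σ_N = S_N·(1∕i − 1∕N) + (Σ_{N≤n<i} a_n)∕i`; with `|S_N| ≤ CN` and `|Σ_{N≤n<i} a_n| ≤ C(i − N)` both terms are `≤ C(1 − N∕i)`,
and `1 − N∕i ≤ log(i∕N)`.

WHAT THIS FILE PROVES (0 sorry, 0 def): §1 `sum_abs_le`, `window_sum_abs_le`, `cesaro_abs_le`, HEADLINE **`cesaro_window_le`**, **`cesaro_logLip`**,
`cesaro_slowlyOscillating`; §2 HEADLINE **`cesaro_of_cesaro2`**, `cesaro2_of_cesaro`, **`cesaro2_iff_cesaro`**, `tendsto_of_cesaro2_slowlyOscillating`,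
**`cesaro2_iff_tendsto_of_slowlyOscillating`**; §3 `cesaro_rate_of_cesaro2_window` (P2 #53a `logLip_rate` on σ: every window is admissible).
NOT CLAIMED: Hölder means of order ≥ 3 spelled out (iterate §1–§2 — σ is again bounded by C, `cesaro_abs_le`); the optimized square root (P2 #53d
`sqrt_law` on σ with K = 2C — a one-line application, not filed here to keep this module at import depth 2); `BetaPertH`; Clay.
-/

namespace Summit.QuantumFields.BalabanUV.Beta.EriceFlowEnclosureCesaroTauberianSeqHigherOrder

open Finset Filter Topology
open Summit.QuantumFields.BalabanUV.Beta.EriceFlowEnclosureCesaroTauberianSeq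
  (tendsto_of_cesaro_slowlyOscillating slowlyOscillating_of_logLip cesaro_iff_tendsto_of_slowlyOscillating logLip_rate)

noncomputable section

variable {a : ℕ → ℝ} {C : ℝ}

/-! ## §1 The Cesàro means of a bounded sequence are log-Lipschitz in the window sense -/

/-- `|S_N| ≤ C·N` for |a| ≤ C. [folklore] -/
theorem sum_abs_le (hb : ∀ n, |a n| ≤ C) (N : ℕ) : |∑ n ∈ range N, a n| ≤ C * N := by
  calc |∑ n ∈ range N, a n| ≤ ∑ n ∈ range N, |a n| := abs_sum_le_sum_abs _ _
    _ ≤ ∑ _n ∈ range N, C := sum_le_sum fun n _ => hb n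
    _ = C * N := by rw [sum_const, card_range, nsmul_eq_mul, mul_comm]

/-- `|Σ_{N≤n<i} a_n| ≤ C·(i − N)` for |a| ≤ C and N ≤ i. [folklore] -/
theorem window_sum_abs_le (hb : ∀ n, |a n| ≤ C) {N i : ℕ} (hNi : N ≤ i) :
    |∑ n ∈ Finset.Ico N i, a n| ≤ C * ((i : ℝ) - N) := by
  calc |∑ n ∈ Finset.Ico N i, a n| ≤ ∑ n ∈ Finset.Ico N i, |a n| := abs_sum_le_sum_abs _ _
    _ ≤ ∑ _n ∈ Finset.Ico N i, C := sum_le_sum fun n _ => hb n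
    _ = C * ((i : ℝ) - N) := by rw [sum_const, Nat.card_Ico, nsmul_eq_mul, Nat.cast_sub hNi, mul_comm]

/-- **EVERY CESÀRO MEAN OF A BOUNDED SEQUENCE IS AGAIN BOUNDED BY C**: `|N⁻¹·Σ_{n<N} a_n| ≤ C` (N ≥ 1) — so all Hölder orders stay in the
same class. [folklore] -/
theorem cesaro_abs_le (hb : ∀ n, |a n| ≤ C) {N : ℕ} (hN : 1 ≤ N) : |(N : ℝ)⁻¹ * ∑ n ∈ range N, a n| ≤ C := by
  have hNpos : 0 < (N : ℝ) := Nat.cast_pos.mpr (lt_of_lt_of_le Nat.one_pos hN)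
  rw [abs_mul, abs_of_pos (inv_pos.mpr hNpos), inv_mul_le_iff₀ hNpos, mul_comm]
  exact sum_abs_le hb N

/-- **THE WINDOW ESTIMATE (HEADLINE)**: for |a| ≤ C and `1 ≤ N ≤ i`:  **`|σ_i − σ_N| ≤ 2C·(1 − N∕i)`**
(`σ_i − σ_N = S_N(1∕i − 1∕N) + (Σ_{N≤n<i} a_n)∕i`). [folklore] -/
theorem cesaro_window_le (hb : ∀ n, |a n| ≤ C) {N i : ℕ} (hN : 1 ≤ N) (hNi : N ≤ i) :
    |(i : ℝ)⁻¹ * ∑ n ∈ range i, a n - (N : ℝ)⁻¹ * ∑ n ∈ range N, a n| ≤ 2 * C * (1 - (N : ℝ) / i) := by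
  have hNpos : 0 < (N : ℝ) := Nat.cast_pos.mpr (lt_of_lt_of_le Nat.one_pos hN)
  have hipos : 0 < (i : ℝ) := lt_of_lt_of_le hNpos (Nat.cast_le.mpr hNi)
  have hNi' : (N : ℝ) ≤ i := Nat.cast_le.mpr hNi
  have hC : 0 ≤ C := (abs_nonneg _).trans (hb 0)
  have hS := sum_abs_le hb N
  have hT := window_sum_abs_le hb hNi
  -- the decomposition
  have hdec : (i : ℝ)⁻¹ * ∑ n ∈ range i, a n - (N : ℝ)⁻¹ * ∑ n ∈ range N, a n
      = (∑ n ∈ range N, a n) * ((i : ℝ)⁻¹ - (N : ℝ)⁻¹) + (i : ℝ)⁻¹ * ∑ n ∈ Finset.Ico N i, a n := by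
    rw [← sum_range_add_sum_Ico _ hNi]; ring
  rw [hdec]
  have h1 : |(∑ n ∈ range N, a n) * ((i : ℝ)⁻¹ - (N : ℝ)⁻¹)| ≤ C * (1 - (N : ℝ) / i) := by
    have hsign : (i : ℝ)⁻¹ - (N : ℝ)⁻¹ ≤ 0 := sub_nonpos.mpr ((inv_le_inv₀ hipos hNpos).mpr hNi')
    rw [abs_mul, abs_of_nonpos hsign]
    calc |∑ n ∈ range N, a n| * -((i : ℝ)⁻¹ - (N : ℝ)⁻¹) ≤ C * N * -((i : ℝ)⁻¹ - (N : ℝ)⁻¹) :=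
          mul_le_mul_of_nonneg_right hS (by linarith)
      _ = C * (1 - (N : ℝ) / i) := by field_simp; ring
  have h2 : |(i : ℝ)⁻¹ * ∑ n ∈ Finset.Ico N i, a n| ≤ C * (1 - (N : ℝ) / i) := by
    rw [abs_mul, abs_of_pos (inv_pos.mpr hipos)]
    calc (i : ℝ)⁻¹ * |∑ n ∈ Finset.Ico N i, a n| ≤ (i : ℝ)⁻¹ * (C * ((i : ℝ) - N)) :=
          mul_le_mul_of_nonneg_left hT (inv_nonneg.mpr hipos.le)
      _ = C * (1 - (N : ℝ) / i) := by field_simp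
  calc _ ≤ |(∑ n ∈ range N, a n) * ((i : ℝ)⁻¹ - (N : ℝ)⁻¹)| + |(i : ℝ)⁻¹ * ∑ n ∈ Finset.Ico N i, a n| := abs_add_le _ _
    _ ≤ C * (1 - (N : ℝ) / i) + C * (1 - (N : ℝ) / i) := add_le_add h1 h2
    _ = 2 * C * (1 - (N : ℝ) / i) := by ring

/-- **THE CESÀRO MEANS OF A BOUNDED SEQUENCE ARE 2C-LOG-LIPSCHITZ**: `|σ_i − σ_N| ≤ 2C·log(i∕N)` for `1 ≤ N ≤ i` (`1 − N∕i ≤ log(i∕N)`).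
The discrete twin of P2 #52a `cesaro_logLip`. [folklore] -/
theorem cesaro_logLip (hb : ∀ n, |a n| ≤ C) :
    ∀ N i : ℕ, 1 ≤ N → N ≤ i →
      |(i : ℝ)⁻¹ * ∑ n ∈ range i, a n - (N : ℝ)⁻¹ * ∑ n ∈ range N, a n| ≤ 2 * C * Real.log ((i : ℝ) / N) := by
  intro N i hN hNi
  have hNpos : 0 < (N : ℝ) := Nat.cast_pos.mpr (lt_of_lt_of_le Nat.one_pos hN)
  have hipos : 0 < (i : ℝ) := lt_of_lt_of_le hNpos (Nat.cast_le.mpr hNi)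
  have hC : 0 ≤ C := (abs_nonneg _).trans (hb 0)
  have hlog : 1 - (N : ℝ) / i ≤ Real.log ((i : ℝ) / N) := by
    have h := Real.log_le_sub_one_of_pos (div_pos hNpos hipos)
    rw [Real.log_div hNpos.ne' hipos.ne'] at h
    rw [Real.log_div hipos.ne' hNpos.ne']
    linarith
  exact (cesaro_window_le hb hN hNi).trans (mul_le_mul_of_nonneg_left hlog (by positivity))

/-- … hence SLOWLY OSCILLATING at ∞, with NO hypothesis on a beyond boundedness (P2 #53a `slowlyOscillating_of_logLip` with K = 2C + 1).
[folklore] -/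
theorem cesaro_slowlyOscillating (hb : ∀ n, |a n| ≤ C) :
    ∀ ε > 0, ∃ q > (1:ℝ), ∃ N₀ : ℕ, ∀ N i : ℕ, N₀ ≤ N → N ≤ i → (i : ℝ) ≤ q * N →
      |(i : ℝ)⁻¹ * ∑ n ∈ range i, a n - (N : ℝ)⁻¹ * ∑ n ∈ range N, a n| ≤ ε := by
  have hC : 0 ≤ C := (abs_nonneg _).trans (hb 0)
  refine slowlyOscillating_of_logLip (a := fun N => (N : ℝ)⁻¹ * ∑ n ∈ range N, a n) (K := 2 * C + 1)
    (by positivity) le_rfl fun N i hN hNi => ?_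
  have hNpos : 0 < (N : ℝ) := Nat.cast_pos.mpr (lt_of_lt_of_le Nat.one_pos hN)
  have hlog0 : 0 ≤ Real.log ((i : ℝ) / N) := Real.log_nonneg ((one_le_div hNpos).mpr (Nat.cast_le.mpr hNi))
  calc _ ≤ 2 * C * Real.log ((i : ℝ) / N) := cesaro_logLip hb N i hN hNi
    _ ≤ (2 * C + 1) * Real.log ((i : ℝ) / N) := by nlinarith

/-! ## §2 The (C,2) datum is the (C,1) datum for bounded sequences -/

/-- **HIGHER CESÀRO ORDERS ADD NOTHING FOR BOUNDED SEQUENCES (HEADLINE)**: |a| ≤ C and the (C,2) means converge,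
`N⁻¹·Σ_{n<N} σ_n → m` ⟹ **`σ_N → m`** — Schmidt's theorem (P2 #53a) applied to the slowly oscillating sequence σ; NO clause on a.
The discrete twin of P2 #52a `cesaro_of_cesaro2`. [folklore] -/
theorem cesaro_of_cesaro2 (hb : ∀ n, |a n| ≤ C) {m : ℝ}
    (h2 : Tendsto (fun N : ℕ => (N : ℝ)⁻¹ * ∑ n ∈ range N, ((n : ℝ)⁻¹ * ∑ k ∈ range n, a k)) atTop (𝓝 m)) :
    Tendsto (fun N : ℕ => (N : ℝ)⁻¹ * ∑ n ∈ range N, a n) atTop (𝓝 m) :=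
  tendsto_of_cesaro_slowlyOscillating (a := fun N => (N : ℝ)⁻¹ * ∑ n ∈ range N, a n) h2 (cesaro_slowlyOscillating hb)

/-- The Abelian direction (no hypothesis): `σ_N → m ⟹ N⁻¹·Σ_{n<N} σ_n → m` (Mathlib `Filter.Tendsto.cesaro`). [folklore] -/
theorem cesaro2_of_cesaro {m : ℝ} (h1 : Tendsto (fun N : ℕ => (N : ℝ)⁻¹ * ∑ n ∈ range N, a n) atTop (𝓝 m)) :
    Tendsto (fun N : ℕ => (N : ℝ)⁻¹ * ∑ n ∈ range N, ((n : ℝ)⁻¹ * ∑ k ∈ range n, a k)) atTop (𝓝 m) :=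
  h1.cesaro

/-- **(C,2) ⟺ (C,1) FOR BOUNDED SEQUENCES**: for |a| ≤ C and every m, `N⁻¹·Σ_{n<N} σ_n → m ⟺ σ_N → m`. [folklore] -/
theorem cesaro2_iff_cesaro (hb : ∀ n, |a n| ≤ C) (m : ℝ) :
    Tendsto (fun N : ℕ => (N : ℝ)⁻¹ * ∑ n ∈ range N, ((n : ℝ)⁻¹ * ∑ k ∈ range n, a k)) atTop (𝓝 m) ↔
      Tendsto (fun N : ℕ => (N : ℝ)⁻¹ * ∑ n ∈ range N, a n) atTop (𝓝 m) :=
  ⟨cesaro_of_cesaro2 hb, cesaro2_of_cesaro⟩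

/-- Two levels down in the Tauberian class: |a| ≤ C, a slowly oscillating and the (C,2) means → m ⟹ `a_n → m`. [folklore] -/
theorem tendsto_of_cesaro2_slowlyOscillating (hb : ∀ n, |a n| ≤ C)
    (hso : ∀ ε > 0, ∃ q > (1:ℝ), ∃ N₀ : ℕ, ∀ N i : ℕ, N₀ ≤ N → N ≤ i → (i : ℝ) ≤ q * N → |a i - a N| ≤ ε) {m : ℝ}
    (h2 : Tendsto (fun N : ℕ => (N : ℝ)⁻¹ * ∑ n ∈ range N, ((n : ℝ)⁻¹ * ∑ k ∈ range n, a k)) atTop (𝓝 m)) :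
    Tendsto a atTop (𝓝 m) :=
  tendsto_of_cesaro_slowlyOscillating (cesaro_of_cesaro2 hb h2) hso

/-- **ALL ORDERS, ONE DATUM IN THE TAUBERIAN CLASS**: for |a| ≤ C slowly oscillating and every m:
`N⁻¹·Σ_{n<N} σ_n → m ⟺ σ_N → m ⟺ a_n → m` (stated as the conjunction of the two equivalences). [folklore] -/
theorem cesaro2_iff_tendsto_of_slowlyOscillating (hb : ∀ n, |a n| ≤ C)
    (hso : ∀ ε > 0, ∃ q > (1:ℝ), ∃ N₀ : ℕ, ∀ N i : ℕ, N₀ ≤ N → N ≤ i → (i : ℝ) ≤ q * N → |a i - a N| ≤ ε) (m : ℝ) :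
    (Tendsto (fun N : ℕ => (N : ℝ)⁻¹ * ∑ n ∈ range N, ((n : ℝ)⁻¹ * ∑ k ∈ range n, a k)) atTop (𝓝 m) ↔
        Tendsto (fun N : ℕ => (N : ℝ)⁻¹ * ∑ n ∈ range N, a n) atTop (𝓝 m)) ∧
      (Tendsto (fun N : ℕ => (N : ℝ)⁻¹ * ∑ n ∈ range N, a n) atTop (𝓝 m) ↔ Tendsto a atTop (𝓝 m)) :=
  ⟨cesaro2_iff_cesaro hb m, cesaro_iff_tendsto_of_slowlyOscillating hso m⟩

/-! ## §3 The rate inherited from one scale -/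

/-- **RATE**: |a| ≤ C and the (C,2) means within `E n` of m for n ≥ 1 ⟹ for every window `1 ≤ N < J`:
**`|σ_N − m| ≤ 2C·log(J∕N) + (J·E J + N·E N)∕(J − N)`** (P2 #53a `logLip_rate` on σ; J ≈ N(1 + √E) gives the square root of P2 #53d). [folklore] -/
theorem cesaro_rate_of_cesaro2_window (hb : ∀ n, |a n| ≤ C) {m : ℝ} {E : ℕ → ℝ}
    (hE : ∀ n : ℕ, 1 ≤ n → |(n : ℝ)⁻¹ * ∑ k ∈ range n, ((k : ℝ)⁻¹ * ∑ j ∈ range k, a j) - m| ≤ E n)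
    {N J : ℕ} (hN : 1 ≤ N) (hNJ : N < J) :
    |(N : ℝ)⁻¹ * ∑ n ∈ range N, a n - m| ≤ 2 * C * Real.log ((J : ℝ) / N) + ((J : ℝ) * E J + N * E N) / ((J : ℝ) - N) := by
  have hC : 0 ≤ C := (abs_nonneg _).trans (hb 0)
  exact logLip_rate (a := fun N => (N : ℝ)⁻¹ * ∑ n ∈ range N, a n) (by positivity) le_rfl
    (fun N i hN' hNi => cesaro_logLip hb N i hN' hNi) hE hN hNJ

end

end Summit.QuantumFields.BalabanUV.Beta.EriceFlowEnclosureCesaroTauberianSeqHigherOrder
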